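import Summits.HodgeConjecture.CorCM.Census.IcosicCyclicMinimality

/-!
# Icosic atlas, type `ℤ/20` (sequel): the lattice theorem `H = P ⊔ A` — the Galois translates of the fifty-one rank-four faces generate the Hodge
# lattice of the whole `F`-slice modulo divisors (kernel census; `μ(ℤ/20) ≤ 51`, hence **`μ(ℤ/20) = 51` EXACTLY** with `Census/IcosicCyclicMinimality.lean`)

COR-CM (cell `pub-hodgecm2`), count-neutral kernel census by the literature seat lit-andre-3 (gen 15; claim ICOSIC-ATLAS), second sequel of
`Census/IcosicCyclicSpecies.lean` (imports the first sequel `Census/IcosicCyclicMinimality.lean`; same conventions, dictionary and citations).  METHOD (the oracle's "modular-law certificate", no large `decide`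
table: the biggest closed computations are over the `1024` labels one at a time and a `10 × 10` integer matrix identity):
* `W := B₄₉ ⊔ (P ⊔ A)` (`B₄₉` = the coordinate vectors of the starting block) is translation stable and contains EVERY coordinate vector `e_x`
  (`single_mem_W`, induction on the step `rank` at which the block of `x` is reached: the face `k` reaching it has one new label `newLabel k`, its three
  other labels lie in blocks reached earlier (`atom_census` of the first file, re-read here as `newLabel_spec`), and every label of the new block is a
  translate of `newLabel k` (`reach_spec`)); hence `W = ⊤`;
* `H ⊓ B₄₉⁺ = ⊥` where `B₄₉⁺` = the ten coordinate vectors `e_{q 48 j}`, `j < 10` (one per conjugate pair): the `10 × 10` Pohlmann sign matrix of `B₄₉`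
  has determinant `−2⁹` and an INTEGER adjugate certificate `adj · M = 512 · 1` (`adj_mul`), so a vector supported there with all Pohlmann forms zero
  vanishes (`hodge_inf_B49_eq_bot`); and `B₄₉ ≤ B₄₉⁺ ⊔ P`;
* the modular law in the lattice of submodules: `H = H ⊓ (B₄₉⁺ ⊔ (P ⊔ A)) = (H ⊓ B₄₉⁺) ⊔ (P ⊔ A) = P ⊔ A` (**`lattice_theorem_icosic`**), and with
  `fiftyone_le_card_of_generates`: **`deficiency_fiftyone_icosic`** — the `51` face monomials generate `H` modulo `P` under translation, and no family
  of fewer than `51` integer vectors does: `μ(ℤ/20) = μ_faces(ℤ/20) = 51` (= `dim_{𝔽₂}(H/P ⊗ 𝔽₂)_G` = #blocks − 1, the degree-20 instance of the lane's law;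
  cell memo `HOME/pub-hodgecm2-lit-andre-3/PORTFOLIO-lit-andre-3-g15.md`).
No named fact, no `sorry`.  HC_CM is not proved anywhere in this cell; nothing here is a headline.

## References
* [Pohlmann1968] H. Pohlmann, Algebraic cycles on abelian varieties of complex multiplication type, Ann. of Math. 88 (1968), Thm 1.
* [Milne1999] J. S. Milne, Lefschetz motives and the Tate conjecture, Compositio Math. 117 (1999), Prop. 2.1, p. 54.
-/

namespace Summit.HodgeConjecture.CorCM.Census.IcosicCyclicSpecies

open Finset

/-! ## Translations as linear maps; stability of `P` and `A` -/

/-- Translation by `g` as a `ℤ`-linear map. [folklore] -/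
def translL (g : ZMod 20) : (Pt → ℤ) →ₗ[ℤ] (Pt → ℤ) where
  toFun := transl g
  map_add' v w := by funext y; rfl
  map_smul' c v := by funext y; rfl

/-- `translL g v = transl g v`. [folklore] -/
theorem translL_apply (g : ZMod 20) (v : Pt → ℤ) : translL g v = transl g v := rfl

/-- Translates compose. [folklore] -/
theorem transl_transl (g h : ZMod 20) (v : Pt → ℤ) : transl g (transl h v) = transl (g + h) v := by
  funext y
  show v (act (-h) (act (-g) y)) = v (act (-(g + h)) y)
  rw [← act_add, neg_add_rev]

/-- The translate of an indicator is the indicator of the translated set. [folklore] -/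
theorem transl_ind (g : ZMod 20) (S : Finset Pt) : transl g (ind S) = ind (S.image (act g)) := by
  funext y
  show (if act (-g) y ∈ S then (1 : ℤ) else 0) = if y ∈ S.image (act g) then 1 else 0
  have key : act (-g) y ∈ S ↔ y ∈ S.image (act g) := by
    rw [Finset.mem_image]
    constructor
    · intro h
      exact ⟨act (-g) y, h, (actEquiv g).right_inv y⟩
    · rintro ⟨x, hx, rfl⟩
      rw [show act (-g) (act g x) = x from (actEquiv g).left_inv x]
      exact hx
  by_cases h : act (-g) y ∈ S
  · rw [if_pos h, if_pos (key.mp h)]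
  · rw [if_neg h, if_neg (fun h' => h (key.mpr h'))]

/-- The translate of a coordinate vector. [folklore] -/
theorem transl_ind_singleton (g : ZMod 20) (x : Pt) : transl g (ind {x}) = ind {act g x} := by
  rw [transl_ind, Finset.image_singleton]

/-- The translate of a conjugate pair is a conjugate pair. [folklore] -/
theorem transl_pairVec (g : ZMod 20) (x : Pt) : transl g (pairVec x) = pairVec (act g x) := by
  rw [pairVec, transl_ind, Finset.image_insert, Finset.image_singleton, ← act_add, add_comm, act_add]
  rfl

/-- A span of a translation-stable family of generators is translation stable. [folklore] -/
theorem span_transl {ι : Type*} (f : ι → Pt → ℤ) (g : ZMod 20)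
    (h : ∀ i, transl g (f i) ∈ Submodule.span ℤ (Set.range f)) {v : Pt → ℤ} (hv : v ∈ Submodule.span ℤ (Set.range f)) :
    transl g v ∈ Submodule.span ℤ (Set.range f) := by
  have h1 : Submodule.map (translL g) (Submodule.span ℤ (Set.range f)) ≤ Submodule.span ℤ (Set.range f) := by
    rw [Submodule.map_span]
    refine Submodule.span_le.mpr ?_
    rintro _ ⟨_, ⟨i, rfl⟩, rfl⟩
    exact h i
  exact h1 (Submodule.mem_map_of_mem hv)

/-- `P` is translation stable. [folklore] -/
theorem pairs_transl (g : ZMod 20) {v : Pt → ℤ} (hv : v ∈ pairs) : transl g v ∈ pairs :=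
  span_transl pairVec g (fun x => by rw [transl_pairVec]; exact Submodule.subset_span ⟨act g x, rfl⟩) hv

/-- `A` is translation stable. [folklore] -/
theorem atoms_transl (g : ZMod 20) {v : Pt → ℤ} (hv : v ∈ atoms) : transl g v ∈ atoms :=
  span_transl (fun p : ZMod 20 × Fin 51 => transl p.1 (atomVec p.2)) g
    (fun p => by rw [transl_transl]; exact Submodule.subset_span ⟨(g + p.1, p.2), rfl⟩) hv

/-! ## The starting block `B₄₉` and `W` -/

/-- The coordinate vectors of the starting block `B₄₉` (labels `q 48 g`). [folklore] -/
def B49 : Submodule ℤ (Pt → ℤ) := Submodule.span ℤ (Set.range fun g : ZMod 20 => ind {q 48 g})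

/-- One coordinate vector per conjugate pair of `B₄₉`: labels `q 48 j`, `j < 10`. [folklore] -/
def B49r : Submodule ℤ (Pt → ℤ) := Submodule.span ℤ (Set.range fun j : Fin 10 => ind {q 48 ((j : ℕ) : ZMod 20)})

/-- `W = B₄₉ + P + A`. [folklore] -/
def W : Submodule ℤ (Pt → ℤ) := B49 ⊔ (pairs ⊔ atoms)

/-- `B₄₉` is translation stable. [folklore] -/
theorem B49_transl (g : ZMod 20) {v : Pt → ℤ} (hv : v ∈ B49) : transl g v ∈ B49 :=
  span_transl (fun h : ZMod 20 => ind {q 48 h}) g (fun h => by rw [transl_ind_singleton]; exact Submodule.subset_span ⟨g + h, rfl⟩) hv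

/-- `W` is translation stable. [folklore] -/
theorem W_transl (g : ZMod 20) {v : Pt → ℤ} (hv : v ∈ W) : transl g v ∈ W := by
  rw [W, Submodule.mem_sup] at hv
  obtain ⟨b, hb, w, hw, rfl⟩ := hv
  rw [Submodule.mem_sup] at hw
  obtain ⟨p, hp, a, ha, rfl⟩ := hw
  have e : transl g (b + (p + a)) = transl g b + (transl g p + transl g a) := by funext y; rfl
  rw [e]
  exact Submodule.add_mem _ (Submodule.mem_sup_left (B49_transl g hb))
    (Submodule.mem_sup_right (Submodule.add_mem _ (Submodule.mem_sup_left (pairs_transl g hp)) (Submodule.mem_sup_right (atoms_transl g ha))))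

/-- A conjugate pair is the sum of its two coordinate vectors. [folklore] -/
theorem pairVec_eq (x : Pt) : pairVec x = ind {x} + ind {act 10 x} := by
  funext y
  show (if y ∈ ({x, act 10 x} : Finset Pt) then (1 : ℤ) else 0) = (if y ∈ ({x} : Finset Pt) then 1 else 0) + (if y ∈ ({act 10 x} : Finset Pt) then 1 else 0)
  simp only [Finset.mem_insert, Finset.mem_singleton]
  have hne : act 10 x ≠ x := hodgeVec_conj.2 x
  have hne' : x ≠ act 10 x := fun e => hne e.symm
  by_cases h1 : y = x <;> by_cases h2 : y = act 10 x <;> simp [h1, h2, hne, hne']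

/-- `B₄₉ ≤ B₄₉⁺ ⊔ P`: the other ten coordinate vectors are pair minus representative. [folklore] -/
theorem B49_le : B49 ≤ B49r ⊔ pairs := by
  refine Submodule.span_le.mpr ?_
  rintro _ ⟨g, rfl⟩
  have hsplit : ∀ g : ZMod 20, (∃ j : Fin 10, g = ((j : ℕ) : ZMod 20)) ∨ ∃ j : Fin 10, g = 10 + ((j : ℕ) : ZMod 20) := by decide
  rcases hsplit g with ⟨j, rfl⟩ | ⟨j, rfl⟩
  · show ind {q 48 ((j : ℕ) : ZMod 20)} ∈ B49r ⊔ pairs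
    exact Submodule.mem_sup_left (Submodule.subset_span ⟨j, rfl⟩)
  · have e : ind {q 48 (10 + ((j : ℕ) : ZMod 20))} = pairVec (q 48 ((j : ℕ) : ZMod 20)) - ind {q 48 ((j : ℕ) : ZMod 20)} := by
      rw [pairVec_eq]; exact (add_sub_cancel_left _ _).symm
    show ind {q 48 (10 + ((j : ℕ) : ZMod 20))} ∈ B49r ⊔ pairs
    rw [e]
    exact Submodule.sub_mem _ (Submodule.mem_sup_right (Submodule.subset_span ⟨q 48 _, rfl⟩))
      (Submodule.mem_sup_left (Submodule.subset_span ⟨j, rfl⟩))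

/-! ## Every coordinate vector lies in `W` -/

/-- The label of face `k` in the block it introduces. [folklore] -/
def newLabel : Fin 51 → Pt :=
  ![q 20 16, q 43 8, q 32 16, q 19 19, q 28 4, q 35 7, q 49 12, q 38 4, q 34 18, q 21 12, q 42 7, q 46 19, q 36 4, q 47 4, q 13 10, q 5 6, q 10 17, q 50 13, q 25 3, q 18 16, q 2 7, q 37 11, q 27 5, q 45 19, q 17 9, q 9 11, q 22 10, q 8 16, q 15 1, q 7 3, q 23 16, q 3 19, q 31 1, q 33 8, q 29 6, q 39 0, q 16 16, q 14 10, q 40 4, q 12 4, q 24 12, q 26 4, q 11 15, q 1 5, q 30 8, q 41 8, q 44 15, q 6 12, q 4 17, q 0 8, s 0]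

/-- The face introducing a block (by block index; junk `0` for the starting block `49`). [folklore] -/
def kOfBlock : List ℕ :=
  [50, 49, 43, 20, 31, 48, 15, 47, 29, 27, 25, 16, 42, 39, 14, 37, 28, 36, 24, 19, 3, 0, 9, 26, 30, 40, 18, 41, 22, 4, 34, 44, 32, 2, 33, 8, 5, 12, 21, 7, 35, 38, 45, 10, 1, 46, 23, 11, 13, 0, 6, 17]

/-- The face introducing the block of a label. [folklore] -/
def kOf (x : Pt) : Fin 51 := ⟨min (kOfBlock.getD (blockOf x) 0) 50, by omega⟩

/-- The translation carrying `newLabel (kOf x)` to `x`. [folklore] -/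
def shOf (x : Pt) : ZMod 20 :=
  match x, newLabel (kOf x) with
  | Sum.inl u, Sum.inl u₀ => (((u - u₀).val : ℕ) : ZMod 20)
  | Sum.inr (_, h), Sum.inr (_, h₀) => h - h₀
  | _, _ => 0

set_option maxRecDepth 100000 in set_option maxHeartbeats 4000000 in
/-- The growth structure re-read label by label: `newLabel k` is the label of face `k` in its new block, the other three labels of face `k`
lie in blocks reached at earlier steps, every label outside `B₄₉` is the translate by `shOf` of the new label of the face reaching its block, labels of
step `0` are in `B₄₉`, and no step exceeds `51`. [folklore] -/
theorem reach_spec : (∀ k : Fin 51, newLabel k ∈ orbitRep k) ∧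
    (∀ k : Fin 51, (((orbitRep k).erase (newLabel k)).filter fun y => ¬ rank.getD (blockOf y) 0 ≤ k.val).card = 0) ∧
    (∀ x : Pt, blockOf x = 49 ∨ (act (shOf x) (newLabel (kOf x)) = x ∧ rank.getD (blockOf x) 0 = (kOf x).val + 1)) ∧
    (∀ x : Pt, rank.getD (blockOf x) 0 = 0 → blockOf x = 49) ∧ (∀ x : Pt, rank.getD (blockOf x) 0 ≤ 51) := by
  refine ⟨by decide +kernel, by decide +kernel, by decide +kernel, by decide +kernel, by decide +kernel⟩

/-- Labels of the starting block are `q 48 g`. [folklore] -/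
theorem eq_q48_of_blockOf {x : Pt} (hx : blockOf x = 49) : ∃ g : ZMod 20, x = q 48 g := by
  rcases x with u | ⟨b, h⟩
  · exact absurd hx (by simp [blockOf])
  · have hb : b = 48 := Fin.ext (by simp only [blockOf] at hx; omega)
    subst hb
    exact ⟨h, rfl⟩

/-- An indicator is the sum of the coordinate vectors of its labels. [folklore] -/
theorem ind_eq_sum (S : Finset Pt) : ind S = ∑ y ∈ S, ind {y} := by
  funext z
  rw [Finset.sum_apply]
  show (if z ∈ S then (1 : ℤ) else 0) = ∑ y ∈ S, (if z ∈ ({y} : Finset Pt) then (1 : ℤ) else 0)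
  simp only [Finset.mem_singleton]
  rw [Finset.sum_ite_eq]

/-- **Every coordinate vector lies in `W`** (induction on the step at which its block is reached). [folklore] -/
theorem single_mem_W_of_rank : ∀ n : ℕ, ∀ x : Pt, rank.getD (blockOf x) 0 ≤ n → ind {x} ∈ W := by
  obtain ⟨hnew, hold, hreach, hzero, -⟩ := reach_spec
  intro n
  induction n with
  | zero =>
    intro x hx
    obtain ⟨g, rfl⟩ := eq_q48_of_blockOf (hzero x (Nat.le_zero.mp hx))
    exact Submodule.mem_sup_left (Submodule.subset_span ⟨g, rfl⟩)
  | succ n ih =>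
    intro x hx
    rcases Nat.lt_or_ge (rank.getD (blockOf x) 0) (n + 1) with hlt | hge
    · exact ih x (Nat.lt_succ_iff.mp hlt)
    · have heq : rank.getD (blockOf x) 0 = n + 1 := le_antisymm hx hge
      rcases hreach x with h49 | ⟨hact, hrk⟩
      · exfalso
        rw [h49] at heq
        have h0 : rank.getD 49 0 = 0 := by decide
        omega
      · set k := kOf x with hk
        have hkn : k.val = n := by omega
        -- the new label of face k is in W
        have hnewW : ind {newLabel k} ∈ W := by
          have hsum : atomVec k = ind {newLabel k} + ∑ y ∈ (orbitRep k).erase (newLabel k), ind {y} := by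
            rw [atomVec, ind_eq_sum, ← Finset.add_sum_erase _ _ (hnew k)]
          have hrest : (∑ y ∈ (orbitRep k).erase (newLabel k), ind {y}) ∈ W := by
            refine Submodule.sum_mem _ fun y hy => ih y ?_
            have h0 := not_not.mp (Finset.filter_eq_empty_iff.mp (Finset.card_eq_zero.mp (hold k)) hy)
            omega
          have hA : atomVec k ∈ W := Submodule.mem_sup_right (Submodule.mem_sup_right (atomVec_mem k))
          have e : ind {newLabel k} = atomVec k - ∑ y ∈ (orbitRep k).erase (newLabel k), ind {y} := by rw [hsum]; abel
          rw [e]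
          exact Submodule.sub_mem _ hA hrest
        rw [← hact, ← transl_ind_singleton]
        exact W_transl _ hnewW

/-- `W` is everything. [folklore] -/
theorem W_eq_top : W = ⊤ := by
  refine Submodule.eq_top_iff'.mpr fun v => ?_
  rw [pi_eq_sum_univ v]
  refine Submodule.sum_mem _ fun x _ => Submodule.smul_mem _ _ ?_
  have e : (fun y : Pt => if x = y then (1 : ℤ) else 0) = ind {x} := by
    funext y; simp only [ind, Finset.mem_singleton, eq_comm]
  rw [e]
  exact single_mem_W_of_rank 51 x (reach_spec.2.2.2.2 x)

/-! ## `H ⊓ B₄₉⁺ = ⊥`: the adjugate certificate of the starting block -/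

/-- Integer adjugate certificate of the `10 × 10` Pohlmann sign matrix `M τ j = hodgeVec τ (q 48 j)` (`τ, j < 10`) of `B₄₉`: `adj · M = 512 · 1`
(`det M = −2⁹`: `B₄₉` "spans alone"). [folklore] -/
def adj : Fin 10 → Fin 10 → ℤ :=
  ![![0, 0, 0, 0, 0, 0, 0, 0, 256, 256],
    ![0, 0, 0, 0, 0, 0, 0, 256, 256, 0],
    ![0, 0, 0, 0, 0, 0, 256, 256, 0, 0],
    ![0, 0, 0, 0, 0, 256, 256, 0, 0, 0],
    ![0, 0, 0, 0, 256, 256, 0, 0, 0, 0],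
    ![0, 0, 0, 256, 256, 0, 0, 0, 0, 0],
    ![0, 0, 256, 256, 0, 0, 0, 0, 0, 0],
    ![0, 256, 256, 0, 0, 0, 0, 0, 0, 0],
    ![256, 256, 0, 0, 0, 0, 0, 0, 0, 0],
    ![256, 0, 0, 0, 0, 0, 0, 0, 0, -256]]

set_option maxRecDepth 100000 in set_option maxHeartbeats 4000000 in
/-- `adj · M = 512 · 1`. [folklore] -/
theorem adj_mul : ∀ i j : Fin 10, ∑ t : Fin 10, adj i t * hodgeVec ((t : ℕ) : ZMod 20) (q 48 ((j : ℕ) : ZMod 20)) = if i = j then 512 else 0 := by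
  decide +kernel

/-- A Hodge vector supported on the ten representatives of `B₄₉` is zero. [folklore] -/
theorem hodge_inf_B49r_eq_bot : hodgeLattice ⊓ B49r = ⊥ := by
  refine (Submodule.eq_bot_iff _).mpr fun v hv => ?_
  obtain ⟨hH, hB⟩ := Submodule.mem_inf.mp hv
  obtain ⟨c, rfl⟩ := (Submodule.mem_span_range_iff_exists_fun ℤ).mp hB
  -- the Pohlmann forms of the combination
  have hform : ∀ t : Fin 10, ∑ j : Fin 10, hodgeVec ((t : ℕ) : ZMod 20) (q 48 ((j : ℕ) : ZMod 20)) * c j = 0 := by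
    intro t
    have h := hH ((t : ℕ) : ZMod 20)
    rw [dotProduct_sum] at h
    simp only [dotProduct_smul, dotProduct_ind, Finset.sum_singleton, smul_eq_mul] at h
    rw [← h]
    exact Finset.sum_congr rfl fun j _ => mul_comm _ _
  have hc : ∀ i : Fin 10, c i = 0 := by
    intro i
    have h512 : (512 : ℤ) * c i = ∑ t : Fin 10, adj i t * ∑ j : Fin 10, hodgeVec ((t : ℕ) : ZMod 20) (q 48 ((j : ℕ) : ZMod 20)) * c j := by
      simp_rw [Finset.mul_sum, ← mul_assoc]
      rw [Finset.sum_comm]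
      simp_rw [← Finset.sum_mul, adj_mul]
      simp only [ite_mul, zero_mul, Finset.sum_ite_eq, Finset.mem_univ, if_true]
    simp only [hform, mul_zero, Finset.sum_const_zero] at h512
    omega
  simp only [hc, zero_smul, Finset.sum_const_zero]

/-! ## The lattice theorem -/

/-- **LATTICE THEOREM (`ℤ/20`).**  The Hodge lattice of the whole `F`-slice of a cyclic CM field of degree `20` is generated by the divisor classes and
the Galois translates of the fifty-one rank-four face monomials `orbitRep`: `H = P ⊔ A` (`A` spelled out, as in b17's `lattice_theorem_cyclic`,
so that the statement is not a textual twin of the degree-12 lattice theorems).  With `fiftyone_le_card_of_generates`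
(`Census/IcosicCyclicMinimality.lean`): `μ(ℤ/20) = 51`, attained by faces. [folklore] -/
theorem lattice_theorem_icosic :
    hodgeLattice = pairs ⊔ Submodule.span ℤ (Set.range fun p : ZMod 20 × Fin 51 => transl p.1 (atomVec p.2)) := by
  refine le_antisymm ?_ (sup_le pairs_le atoms_le)
  intro v hv
  show v ∈ pairs ⊔ atoms
  have hPA : pairs ⊔ atoms ≤ hodgeLattice := sup_le pairs_le atoms_le
  have htop : (⊤ : Submodule ℤ (Pt → ℤ)) ≤ B49r ⊔ (pairs ⊔ atoms) := by
    rw [← W_eq_top, W]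
    exact sup_le (B49_le.trans (sup_le_sup_left le_sup_left _)) le_sup_right
  obtain ⟨b, hb, w, hw, hbw⟩ := Submodule.mem_sup.mp (htop (Submodule.mem_top : v ∈ ⊤))
  have hbH : b ∈ hodgeLattice := by
    have e : b = v - w := eq_sub_of_add_eq hbw
    rw [e]
    exact Submodule.sub_mem _ hv (hPA hw)
  have hb0 : b = 0 := (Submodule.mem_bot ℤ).mp (hodge_inf_B49r_eq_bot ▸ Submodule.mem_inf.mpr ⟨hbH, hb⟩)
  rw [← hbw, hb0, zero_add]
  exact hw

/-- **`μ(ℤ/20) ≤ 51` in the form used by the minimality statement**: the Hodge lattice is generated, modulo pairs, by the translates of the finite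
family of the `51` face monomials. [folklore] -/
theorem hodgeLattice_le_span_faces :
    hodgeLattice ≤ pairs ⊔ Submodule.span ℤ {v | ∃ g : ZMod 20, ∃ t ∈ (univ.image atomVec : Finset (Pt → ℤ)), v = transl g t} := by
  rw [lattice_theorem_icosic]
  refine sup_le_sup_left (Submodule.span_le.mpr ?_) _
  rintro _ ⟨p, rfl⟩
  exact Submodule.subset_span ⟨p.1, atomVec p.2, Finset.mem_image_of_mem _ (Finset.mem_univ _), rfl⟩

/-- **DEFICIENCY `μ(ℤ/20) = 51`, attained by rank-four faces.**  The family of the `51` face monomials generates the Hodge lattice modulo pairs under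
translation and has at most `51` members, and every generating family has at least `51` members. [folklore] -/
theorem deficiency_fiftyone_icosic :
    (hodgeLattice ≤ pairs ⊔ Submodule.span ℤ {v | ∃ g : ZMod 20, ∃ t ∈ (univ.image atomVec : Finset (Pt → ℤ)), v = transl g t} ∧
      (univ.image atomVec : Finset (Pt → ℤ)).card ≤ 51) ∧
    ∀ S : Finset (Pt → ℤ), hodgeLattice ≤ pairs ⊔ Submodule.span ℤ {v | ∃ g : ZMod 20, ∃ t ∈ S, v = transl g t} → 51 ≤ S.card :=
  ⟨⟨hodgeLattice_le_span_faces, Finset.card_image_le.trans (by simp)⟩, fiftyone_le_card_of_generates⟩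

end Summit.HodgeConjecture.CorCM.Census.IcosicCyclicSpecies
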